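import Mathlib.MeasureTheory.Integral.Bochner.Set
import HarnessLib

/-!
# Route `FordMaynardSieveConst01651`, target `SieveConst01651` (stmt-Parity-19185), stub `stub_certValuePos` (R2):
# sums of integrals over pairwise disjoint pieces

Def-free helper file (glue for the `certP`/`certN` soundness, see `…CertAssembly`): for a non-negative function
`f` integrable on a measurable set `T` and a LIST of measurable, pairwise disjoint subsets `S i ⊆ T`,
`Σ_i ∫_{S i} f = ∫_{⋃ S i} f ≤ ∫_T f` (`sum_setIntegral_eq_biUnion`, `sum_setIntegral_le_of_subset`); and without
disjointness the reverse-type bound `∫_T f ≤ Σ_i ∫_{S i} f` when `T ⊆ ⋃ S i` (`setIntegral_le_sum_of_cover`).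
These turn the checker's rectangle sums into bounds for the cell integrals (inner rectangles: lower bound; outer
rectangles: upper bound).

References: folklore.
-/

noncomputable section

open MeasureTheory Set

namespace Summit.Parity.GeneralizedHardyLittlewood.FordMaynardSieveConst01651SieveConst01651

variable {α ι : Type*} [MeasurableSpace α] [Countable ι] {μ : Measure α}

/-- Measurability of a list-indexed union. [folklore] -/
theorem measurableSet_biUnion_list (S : ι → Set α) (hS : ∀ i, MeasurableSet (S i)) (l : List ι) :
    MeasurableSet (⋃ i ∈ l, S i) :=
  MeasurableSet.iUnion fun j => MeasurableSet.iUnion fun _ => hS j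

/-- **Additivity over a pairwise disjoint list**: `Σ_{i ∈ l} ∫_{S i} f = ∫_{⋃_{i∈l} S i} f` (and integrability on the
union). [folklore] -/
theorem sum_setIntegral_eq_biUnion (S : ι → Set α) (hS : ∀ i, MeasurableSet (S i)) (f : α → ℝ) :
    ∀ l : List ι, l.Pairwise (fun i j => Disjoint (S i) (S j)) → (∀ i ∈ l, IntegrableOn f (S i) μ) →
      (l.map fun i => ∫ x in S i, f x ∂μ).sum = ∫ x in ⋃ i ∈ l, S i, f x ∂μ ∧
        IntegrableOn f (⋃ i ∈ l, S i) μ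
  | [], _, _ => by simp
  | i :: l, hpw, hint => by
    rw [List.pairwise_cons] at hpw
    obtain ⟨ih1, ih2⟩ := sum_setIntegral_eq_biUnion S hS f l hpw.2 (fun j hj => hint j (List.mem_cons_of_mem _ hj))
    have hU : (⋃ j ∈ (i :: l), S j) = S i ∪ ⋃ j ∈ l, S j := by
      ext x; simp
    have hdisj : Disjoint (S i) (⋃ j ∈ l, S j) := by
      rw [Set.disjoint_iUnion₂_right]
      exact fun j hj => hpw.1 j hj
    have hi := hint i List.mem_cons_self
    refine ⟨?_, ?_⟩
    · rw [List.map_cons, List.sum_cons, ih1, hU, setIntegral_union hdisj (measurableSet_biUnion_list S hS l) hi ih2]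
    · rw [hU]; exact hi.union ih2

/-- **Lower bound from disjoint pieces inside**: for `f ≥ 0` on `T`, integrable on `T` (measurable), and pairwise
disjoint measurable `S i ⊆ T` (`i ∈ l`): `Σ_{i∈l} ∫_{S i} f ≤ ∫_T f`. [folklore] -/
theorem sum_setIntegral_le_of_subset (S : ι → Set α) (hS : ∀ i, MeasurableSet (S i)) {T : Set α}
    (hT : MeasurableSet T) {f : α → ℝ} (hf : IntegrableOn f T μ) (hf0 : ∀ x ∈ T, 0 ≤ f x)
    (l : List ι) (hpw : l.Pairwise (fun i j => Disjoint (S i) (S j))) (hsub : ∀ i ∈ l, S i ⊆ T) :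
    (l.map fun i => ∫ x in S i, f x ∂μ).sum ≤ ∫ x in T, f x ∂μ := by
  rw [(sum_setIntegral_eq_biUnion S hS f l hpw (fun i hi => hf.mono_set (hsub i hi))).1]
  exact setIntegral_mono_set hf ((ae_restrict_iff' hT).2 (Filter.Eventually.of_forall hf0))
    (Set.iUnion₂_subset fun i hi => hsub i hi).eventuallyLE

/-- **Upper bound from disjoint pieces covering**: for `f ≥ 0` on the pieces, integrable on each (measurable, pairwise
disjoint) `S i`, and `T ⊆ ⋃_{i∈l} S i`: `∫_T f ≤ Σ_{i∈l} ∫_{S i} f`. [folklore] -/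
theorem setIntegral_le_sum_of_cover (S : ι → Set α) (hS : ∀ i, MeasurableSet (S i)) {T : Set α}
    {f : α → ℝ} (l : List ι) (hint : ∀ i ∈ l, IntegrableOn f (S i) μ) (hf0 : ∀ i ∈ l, ∀ x ∈ S i, 0 ≤ f x)
    (hpw : l.Pairwise (fun i j => Disjoint (S i) (S j))) (hcov : T ⊆ ⋃ i ∈ l, S i) :
    ∫ x in T, f x ∂μ ≤ (l.map fun i => ∫ x in S i, f x ∂μ).sum := by
  obtain ⟨h1, h2⟩ := sum_setIntegral_eq_biUnion S hS f l hpw hint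
  rw [h1]
  refine setIntegral_mono_set h2 ((ae_restrict_iff' (measurableSet_biUnion_list S hS l)).2
    (Filter.Eventually.of_forall fun x hx => ?_)) hcov.eventuallyLE
  simp only [Set.mem_iUnion] at hx
  obtain ⟨i, hi, hx⟩ := hx
  exact hf0 i hi x hx

end Summit.Parity.GeneralizedHardyLittlewood.FordMaynardSieveConst01651SieveConst01651

end
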